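import Mathlib.MeasureTheory.Integral.Bochner.Set
import Mathlib.MeasureTheory.Measure.Haar.InnerProductSpace
import Mathlib.MeasureTheory.Function.LocallyIntegrable
import Literature.Barriers.AtomisticToContinuum.NoBVEstimatesMultiDProofs
import HarnessLib

/-!
# Rauch's small-amplitude expansion (`Rauch1986_smallAmplitudeExpansion`), relative to its
two analytic inputs: the `L²` expansion and finite speed of propagation

Companion to `NoBVEstimatesMultiDProofs.lean`, which vendors the first analytic input of the
printed proof of Rauch's Theorem [Rauch1986, pp. 482–483] as the named fact
`Rauch1986_smallAmplitudeExpansion` (classical solutions `u_ε` of (1) with data `ū + εφ` on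
`[0, t̄]` for small `ε > 0`, a classical solution `v` of the linearisation (4) with `v(0) = φ`,
`v(t̄)` and `u_ε(t̄) - ū` compactly supported, and `‖∇ₓu_ε(t̄) - ε∇ₓv(t̄)‖_{L¹} ≤ Cε²`).

The printed paragraph [Rauch1986, p. 482, last lines] obtains this from exactly two inputs,
vendored here as named facts, and this file PROVES the fact relative to them
(`Rauch1986_smallAmplitudeExpansion_of_facts`):

1. `Rauch1986_smallAmplitudeExpansionL2` — "Consider Cauchy data `u_ε(0, ·) = ū + εφ(·)`,
   `φ ∈ C₀^∞(ℝᵈ)`. Then `u_ε = ū + εv + r_ε`, where `v` is the solution of the linearized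
   equation (4), and for any `s > 0`, `sup_{0≤t≤t̄} ‖r_ε(t)‖_{Hˢ(ℝᵈ)} = O(ε²)`. In particular,
   `‖∇ₓr_ε(t̄)‖_{L²(ℝᵈ)} = O(ε²)`" [Rauch1986, p. 482] — the Local Existence Theorem
   [Rauch1986, p. 482] (existence of the `u_ε` on `[0, t̄]` for `ε` small; "The map `φ ↦ u - ū`
   is `C^∞` ... with derivative calculated using the linearized equation", "Modern proofs are
   presented in [4; 5 Chap. 2, 6]" = Lax 1970, [Majda1984, Ch. 2], [Taylor1981, Ch. IV §5])
   together with the second-order Taylor remainder. Vendored in the weak form consumed: the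
   `L²` bound on `∇ₓr_ε` at time `t̄` only ("In particular ...").
2. `Rauch1986_finitePropagationSpeed` — "Using the finite speed of propagation for (1) we see
   that the `r_ε` are supported in a fixed compact subset of `[-t̄, t̄] × ℝᵈ`"
   [Rauch1986, p. 482]: a classical solution of a system (1) in Rauch's class at `ū` whose data
   equal `ū` outside the ball `‖x‖ ≤ R` equals `ū` outside the ball `‖x‖ ≤ R + ct` at time
   `t`, with a speed `c = c(S, ū)` (domain of influence of the constant state; for symmetric
   hyperbolic systems the energy method on space-like truncated cones [Racke2015, Thm 3.1],
   [John1982, Ch. 5 §3 Problem 5], applied to the linear system satisfied by `u - ū`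
   [Rendall2008, §8.3 (8.29)]; for strictly hyperbolic operators [Taylor1981, Ch. IV Thm 4.5]).

Then `Rauch1986_smallAmplitudeExpansion_of_facts` is the remaining, elementary step
"so [`‖∇ₓr_ε(t̄)‖_{L¹} = O(ε²)`]": fact 2 applied to `u_ε` (data `ū + εφ = ū` off
`supp φ ⊆ {‖x‖ ≤ R}`) and to `v` (the linearisation is in Rauch's class at `0`,
`IsRauchClass.linearization`; data `φ = 0` off the same ball) puts the support of
`∇ₓr_ε(t̄) = ∇ₓu_ε(t̄) - ε∇ₓv(t̄)` in the FIXED ball `K = {‖x‖ ≤ R + max(c₁, c₂) t̄}`, and on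
`K` the pointwise inequality `‖g‖ ≤ ‖g‖²/(2ε²) + ε²/2` integrates to
`‖∇ₓr_ε(t̄)‖_{L¹} ≤ (C + |K|) ε²/2` (`integral_norm_le_of_sq_le`, Cauchy–Schwarz in
disguise).

## Contents

* the two named facts; `exists_eq_zero_of_norm_gt`, `fderiv_eq_zero_of_eq_const_of_norm_gt`,
  `hasCompactSupport_sub_const_of_norm_gt`, `integral_norm_le_of_sq_le` (elementary);
  `Rauch1986_smallAmplitudeExpansion_of_facts`.

What is NOT here: proofs of the two facts (`Rauch1986_smallAmplitudeExpansion_holds` is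
`Rauch1986_smallAmplitudeExpansion_of_facts h₂ h₁` once both are discharged). Fact 1 is the
`Hˢ` (`s > d/2 + 1`) local well-posedness theory of quasilinear symmetrizable
[Racke2015, Thm 5.1] (Kato 1975), [Majda1984, Ch. 2] and strictly hyperbolic
[Taylor1981, Ch. IV Thm 5.6] systems — Friedrichs mollifiers, commutator (Moser) estimates,
Sobolev embedding, continuation and continuous dependence at the global solution `ū`, the
linear constant-coefficient theory for (4), and the second-order expansion in `ε`; fact 2 is
the local energy identity on truncated cones (divergence theorem) with a continuity
(bootstrap) argument, resp. the Lipschitz-coefficient `L²` theory with symbolic symmetrizers in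
the strictly hyperbolic case. None of these is in Mathlib at this pin (no `Hˢ(ℝᵈ)` spaces).

Remarks on the source (recorded, not used): (a) the printed lifespan "`|t| < T ≡ c/‖φ‖_{Hˢ}`"
of the Local Existence Theorem [Rauch1986, p. 482] holds for `B ≡ 0`; for a general zeroth-order
term with only `B(ū) = 0` the guaranteed lifespan is `≳ log(1/‖φ‖_{Hˢ})` (e.g. `k = 1`,
`A₀ = 1`, `Aⱼ = 0`, `B(u) = -u - u²`: `∂ₜu = u + u²` blows up at `t = log(1 + 1/max φ)`), which
still tends to `∞` as the data shrink, so existence on `[0, t̄]` for small `ε` — all that is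
used — is unaffected; (b) "`C^∞` from `Hˢ` to `C([-T, T] : Hˢ)`" loses one derivative in
general (the flow map of a quasilinear system is differentiable into `C([-T,T]; H^{s-1})`);
for `φ ∈ C₀^∞` (in every `Hˢ`) the expansion in every `Hˢ` is unaffected.

## References

* [Rauch1986] J. Rauch, *BV estimates fail for most quasilinear hyperbolic systems in
  dimensions greater than one*, Comm. Math. Phys. 106 (1986) 481–484: Local Existence Theorem
  p. 482; Proof of Theorem p. 482 (the expansion `u_ε = ū + εv + r_ε`, finite speed of
  propagation) and p. 483.
* [Kato1975] T. Kato, *The Cauchy problem for quasi-linear symmetric hyperbolic systems*,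
  Arch. Rational Mech. Anal. 58 (1975) 181–205 (origin of the `Hˢ` theory, as reported in
  [Racke2015, Ch. 3 and Ch. 5, ref. [81]]; not consulted here).
* [Racke2015] R. Racke, *Lectures on Nonlinear Evolution Equations. Initial Value Problems*,
  2nd ed. (2015): Ch. 3, Thm 3.1 (energy estimate for `C¹` solutions of linear symmetric
  hyperbolic systems on truncated cones) and the remark after Cor. 3.2 ("finite propagation
  speed"); Ch. 5, Thm 5.1 (local existence and uniqueness of a classical
  `C_b¹ ∩ C([0,T]; W^{s,2})` solution, `s > n/2 + 1`, quasilinear symmetric hyperbolic systems).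
* [John1982] F. John, *Partial Differential Equations*, 4th ed. (1982): Ch. 5 §3, Problem 5
  (space-like truncated cones; a `C¹` solution of a symmetric hyperbolic system is determined in
  the cone by its data on the base).
* [Rendall2008] A. Rendall, *Partial Differential Equations in General Relativity* (2008):
  §8.3, (8.28) (energy identity on lens-shaped regions), (8.29) (the difference of two `C¹`
  solutions of a quasilinear symmetric hyperbolic system solves a linear one), Defs. 8.1–8.2
  (domain of dependence / influence), finite speed of propagation.
* [Taylor1981] M. E. Taylor, *Pseudodifferential Operators* (1981): Ch. IV, §1 (1.7)–(1.9)
  (constant coefficients: skew-symmetrizable symbols, distinct imaginary eigenvalues, bounded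
  perturbations), §4 Thm 4.5 (finite propagation speed, strictly hyperbolic operators), §5
  Thm 5.6 (quasilinear symmetric or strictly hyperbolic systems; Rauch's ref. [6]).
* [Majda1984] A. Majda, *Compressible Fluid Flow and Systems of Conservation Laws in Several
  Space Variables* (1984), Ch. 2 (Rauch's ref. [5]; not consulted here).
-/

noncomputable section

open MeasureTheory Set Filter Topology Metric
open scoped ContDiff

namespace Literature.Barriers.AtomisticToContinuum

open Literature.Analysis.FluidPDE QuasilinearSystem

/-! ### The two analytic inputs of the printed paragraph (named facts) -/

/-- **Rauch's small-amplitude expansion, `L²` form: `u_ε = ū + εv + r_ε` with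
`‖∇ₓr_ε(t̄)‖_{L²(ℝᵈ)} = O(ε²)`** (named fact, NOT proved here). For a system (1) in Rauch's
class at `ū` (`IsRauchClass`: symmetrizable hyperbolic or strictly hyperbolic near `ū`,
`B(ū) = 0`), a time `T > 0` and `φ ∈ C₀^∞(ℝᵈ; ℝᵏ)`: there is a classical solution `v` on
`[0, T]` of the linearised system (4) at `ū` (`S.linearization ū`) with `v(0) = φ`, and there
are classical solutions `u_ε` of (1) on `[0, T]`, for all sufficiently small `ε > 0`, with
`u_ε(0) = ū + εφ`, such that `∇ₓr_ε(T)`, `r_ε = u_ε - ū - εv`, is square integrable with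
`∫ ‖∇ₓu_ε(T) - ε∇ₓv(T)‖² dx ≤ C ε⁴`. Printed: "Consider Cauchy data `u_ε(0, ·) = ū + εφ(·)`,
`φ ∈ C₀^∞(ℝᵈ)`. Then `u_ε = ū + εv + r_ε`, where `v` is the solution of the linearized
equation `[A₀(ū)∂ₜ + Σ Aⱼ(ū)∂ⱼ + B′(ū)]v = 0`, `v|_{t=0} = φ` (4), and for any `s > 0`
`sup_{0≤t≤t̄} ‖r_ε(t)‖_{Hˢ(ℝᵈ)} = O(ε²)`. In particular, `‖∇ₓr_ε(t̄)‖_{L²(ℝᵈ)} = O(ε²)`"; the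
`u_ε` exist on `[0, t̄]` for `ε` small and depend smoothly on the data by the Local Existence
Theorem ("The map `φ ↦ u - ū` is `C^∞` ... with derivative calculated using the linearized
equation ... Modern proofs are presented in [4; 5 Chap. 2, 6]"). Vendored in the weak form the
proof of the Theorem consumes (classical `C¹` solutions, the `L²` bound on the remainder
gradient at time `T` only); the solutions being unique, "there are classical solutions `u_ε`"
reads "the solutions `u_ε`". Its proof is the `Hˢ`, `s > d/2 + 1`, local well-posedness theory
of quasilinear symmetric(rizable) hyperbolic systems [cite: Racke2015, Thm 5.1] (the
method of Lax and Kato; Racke's ref. [81] is Kato 1975) and of strictly hyperbolic systems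
[cite: Taylor1981, Ch. IV §5 Thm 5.6], with continuous dependence at the global solution `ū`
and the second-order expansion in `ε`, none of which is in Mathlib.
[cite: Rauch1986, Local Existence Theorem p. 482 and Proof of Theorem p. 482] -/
def Rauch1986_smallAmplitudeExpansionL2 : Prop :=
  ∀ ⦃d k : ℕ⦄ (S : QuasilinearSystem d k) (ubar : Fin k → ℝ), S.IsRauchClass ubar →
    ∀ ⦃T : ℝ⦄, 0 < T → ∀ φ : Space d → Fin k → ℝ, ContDiff ℝ ∞ φ → HasCompactSupport φ →
      ∃ v : ℝ → Space d → Fin k → ℝ,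
        (S.linearization ubar).IsClassicalSolution T v ∧ (∀ x, v 0 x = φ x) ∧
        ∃ (u : ℝ → ℝ → Space d → Fin k → ℝ) (C : ℝ), ∀ᶠ ε in 𝓝[>] (0 : ℝ),
          S.IsClassicalSolution T (u ε) ∧ (∀ x, u ε 0 x = ubar + ε • φ x) ∧
          Integrable (fun x => ‖fderiv ℝ (u ε T) x - ε • fderiv ℝ (v T) x‖ ^ 2) ∧
          ∫ x, ‖fderiv ℝ (u ε T) x - ε • fderiv ℝ (v T) x‖ ^ 2 ≤ C * ε ^ 4

/-- **Finite speed of propagation for (1): the domain of influence of a constant state**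
(named fact, NOT proved here). For a system (1) in Rauch's class at `ū` there is a speed
`c = c(S, ū) ≥ 0` such that every classical (`C¹`) solution `u` of (1) on `[0, T] × ℝᵈ` whose
Cauchy data equal `ū` outside the ball `‖x‖ ≤ R` satisfies `u(t, x) = ū` for
`‖x‖ > R + ct`, `0 ≤ t ≤ T`. This is the form in which the printed proof uses "the finite
speed of propagation for (1)": "the `r_ε` are supported in a fixed compact subset of
`[-t̄, t̄] × ℝᵈ`" (a support bound uniform over the solutions `u_ε`, `ε → 0`, and valid for the
linearisation (4), itself a system of the form (1) in Rauch's class at `0`). Mechanism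
(symmetrizable case): `w = u - ū` solves the linear symmetric hyperbolic system with `C¹`
coefficients `Sym(u)A₀(u)∂ₜw + Σ Sym(u)Aⱼ(u)∂ⱼw + Sym(u)G(u)w = 0`, `B(u) - B(ū) = G(u)(u - ū)`
[cite: Rendall2008, §8.3 (8.29)], and a `C¹` solution of such a system vanishes in a truncated
cone whose lateral boundary is space-like as soon as it vanishes on the base
[cite: Racke2015, Thm 3.1] [cite: John1982, Ch. 5 §3 Problem 5]; any `c` exceeding the
characteristic speeds of states near `ū` serves, by continuity of `u` on compact cones;
strictly hyperbolic operators: [cite: Taylor1981, Ch. IV §4 Thm 4.5]. Scope: the sources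
print the linear cone estimate (symmetric case, `C¹` coefficients) and the smooth-coefficient
strictly hyperbolic case; the uniform quasilinear statement is the one asserted and used in
[Rauch1986].
[cite: Rauch1986, Proof of Theorem p. 482] -/
def Rauch1986_finitePropagationSpeed : Prop :=
  ∀ ⦃d k : ℕ⦄ (S : QuasilinearSystem d k) (ubar : Fin k → ℝ), S.IsRauchClass ubar →
    ∃ c : ℝ, 0 ≤ c ∧ ∀ (T R : ℝ) (u : ℝ → Space d → Fin k → ℝ), S.IsClassicalSolution T u →
      (∀ x : Space d, R < ‖x‖ → u 0 x = ubar) →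
        ∀ t ∈ Icc 0 T, ∀ x : Space d, R + c * t < ‖x‖ → u t x = ubar

/-! ### Elementary lemmas for the assembly -/

/-- A compactly supported map on `ℝᵈ` vanishes outside some ball: `φ(x) = 0` for `‖x‖ > R`.
[folklore] -/
theorem exists_eq_zero_of_norm_gt {d k : ℕ} {φ : Space d → Fin k → ℝ}
    (hφ : HasCompactSupport φ) : ∃ R : ℝ, ∀ x, R < ‖x‖ → φ x = 0 := by
  obtain ⟨R, hR⟩ := hφ.isCompact.isBounded.subset_closedBall (0 : Space d)
  refine ⟨R, fun x hx => image_eq_zero_of_notMem_tsupport fun hx' => ?_⟩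
  have := hR hx'
  rw [mem_closedBall_zero_iff] at this
  exact absurd this (not_le.2 hx)

/-- A map that is constant on the open exterior region `‖y‖ > ρ` has zero derivative there.
[folklore] -/
theorem fderiv_eq_zero_of_eq_const_of_norm_gt {d k : ℕ} {f : Space d → Fin k → ℝ}
    {c : Fin k → ℝ} {ρ : ℝ} (h : ∀ y, ρ < ‖y‖ → f y = c) {x : Space d} (hx : ρ < ‖x‖) :
    fderiv ℝ f x = 0 := by
  have ho : IsOpen {y : Space d | ρ < ‖y‖} := isOpen_lt continuous_const continuous_norm
  have hfe : f =ᶠ[𝓝 x] fun _ => c :=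
    Filter.eventuallyEq_of_mem (ho.mem_nhds hx) fun y hy => h y hy
  rw [hfe.fderiv_eq, fderiv_const_apply]

/-- A map equal to the constant `c` outside the ball `‖x‖ ≤ ρ` differs from `c` by a compactly
supported map (closed balls of `ℝᵈ` are compact). [folklore] -/
theorem hasCompactSupport_sub_const_of_norm_gt {d k : ℕ} {f : Space d → Fin k → ℝ}
    {c : Fin k → ℝ} {ρ : ℝ} (h : ∀ y, ρ < ‖y‖ → f y = c) :
    HasCompactSupport fun x => f x - c := by
  refine HasCompactSupport.intro (isCompact_closedBall (0 : Space d) ρ) fun x hx => ?_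
  rw [mem_closedBall_zero_iff, not_le] at hx
  simp [h x hx]

/-- **The `L² → L¹` step on a fixed compact support** (the content of Rauch's "so
`‖∇ₓr_ε(t̄)‖_{L¹} = O(ε²)`"): if `g` is integrable, `∫‖g‖² ≤ C ε⁴` with `‖g‖²` integrable,
`ε > 0`, and `g` vanishes outside the ball `‖x‖ ≤ ρ` of volume `V`, then
`∫‖g‖ ≤ (C/2 + V/2) ε²` — integrate the pointwise inequality `‖g‖ ≤ ‖g‖²/(2ε²) + ε²/2` over
the ball (Cauchy–Schwarz with the optimal weight). [folklore] -/
theorem integral_norm_le_of_sq_le {d k : ℕ} {g : Space d → (Space d →L[ℝ] (Fin k → ℝ))}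
    {ρ C ε : ℝ} (hε : 0 < ε) (hgi : Integrable g)
    (hsq : Integrable fun x => ‖g x‖ ^ 2) (hbound : ∫ x, ‖g x‖ ^ 2 ≤ C * ε ^ 4)
    (hsupp : ∀ x, ρ < ‖x‖ → g x = 0) :
    ∫ x, ‖g x‖ ≤ (C / 2 + (volume.real (closedBall (0 : Space d) ρ)) / 2) * ε ^ 2 := by
  set K : Set (Space d) := closedBall (0 : Space d) ρ with hK
  have hKm : MeasurableSet K := measurableSet_closedBall
  have hKfin : volume K < ⊤ := measure_closedBall_lt_top
  -- the dominating function `‖g‖²/(2ε²) + (ε²/2)·𝟙_K`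
  set F : Space d → ℝ := fun x => (2 * ε ^ 2)⁻¹ * ‖g x‖ ^ 2 + K.indicator (fun _ => ε ^ 2 / 2) x
    with hF
  have hIi : Integrable (K.indicator fun _ : Space d => ε ^ 2 / 2) :=
    (integrableOn_const hKfin.ne).integrable_indicator hKm
  have hFi : Integrable F := (hsq.const_mul _).add hIi
  have hpt : ∀ x, ‖g x‖ ≤ F x := by
    intro x
    by_cases hxK : x ∈ K
    · simp only [hF, indicator_of_mem hxK]
      have h2 : 0 < 2 * ε ^ 2 := by positivity
      have key : ‖g x‖ * (2 * ε ^ 2) ≤ ‖g x‖ ^ 2 + ε ^ 4 := by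
        nlinarith [sq_nonneg (‖g x‖ - ε ^ 2)]
      calc ‖g x‖ ≤ (‖g x‖ ^ 2 + ε ^ 4) / (2 * ε ^ 2) := (le_div_iff₀ h2).2 key
        _ = (2 * ε ^ 2)⁻¹ * ‖g x‖ ^ 2 + ε ^ 2 / 2 := by
          field_simp
    · have hx : ρ < ‖x‖ := by
        rwa [hK, mem_closedBall_zero_iff, not_le] at hxK
      simp only [hF, indicator_of_notMem hxK, hsupp x hx, norm_zero]
      positivity
  calc ∫ x, ‖g x‖ ≤ ∫ x, F x := integral_mono hgi.norm hFi hpt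
    _ = (2 * ε ^ 2)⁻¹ * (∫ x, ‖g x‖ ^ 2) + volume.real K * (ε ^ 2 / 2) := by
      rw [hF, integral_add (hsq.const_mul _) hIi, integral_const_mul,
        integral_indicator_const _ hKm, smul_eq_mul]
    _ ≤ (2 * ε ^ 2)⁻¹ * (C * ε ^ 4) + volume.real K * (ε ^ 2 / 2) := by
      gcongr
    _ = (C / 2 + volume.real K / 2) * ε ^ 2 := by
      field_simp

/-! ### The assembly: `Rauch1986_smallAmplitudeExpansion` from the two facts -/

/-- **Rauch's small-amplitude expansion relative to its two analytic inputs.** The printed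
step [Rauch1986, p. 482, last lines]: by `Rauch1986_smallAmplitudeExpansionL2` the solutions
`u_ε` with data `ū + εφ` exist on `[0, t̄]` for small `ε > 0` and
`‖∇ₓu_ε(t̄) - ε∇ₓv(t̄)‖_{L²} ≤ C^{1/2}ε²`; `supp φ ⊆ {‖x‖ ≤ R}` (`exists_eq_zero_of_norm_gt`),
so by `Rauch1986_finitePropagationSpeed` — for (1) at `ū` (data `ū + εφ = ū` off the ball) and
for the linearisation (4), in Rauch's class at `0` (`IsRauchClass.linearization`; data `φ = 0`
off the ball) — `u_ε(t̄) = ū` off `{‖x‖ ≤ R + c₁t̄}` and `v(t̄) = 0` off `{‖x‖ ≤ R + c₂t̄}`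
("the `r_ε` are supported in a fixed compact subset"): this gives the two compact-support
clauses (`hasCompactSupport_sub_const_of_norm_gt`), the vanishing of
`∇ₓr_ε(t̄) = ∇ₓu_ε(t̄) - ε∇ₓv(t̄)` off the fixed ball `K = {‖x‖ ≤ R + max(c₁, c₂)t̄}`
(`fderiv_eq_zero_of_eq_const_of_norm_gt`), and finally
`‖∇ₓr_ε(t̄)‖_{L¹} ≤ (C + |K|)ε²/2` (`integral_norm_le_of_sq_le`), i.e. the `L¹` remainder
bound of `Rauch1986_smallAmplitudeExpansion` with the constant `C/2 + |K|/2`.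
[cite: Rauch1986, Proof of Theorem pp. 482–483] -/
theorem Rauch1986_smallAmplitudeExpansion_of_facts (hE : Rauch1986_smallAmplitudeExpansionL2)
    (hF : Rauch1986_finitePropagationSpeed) : Rauch1986_smallAmplitudeExpansion := by
  intro d k S ubar hS T hT φ hφ hφc
  obtain ⟨v, hv, hv0, u, C, hev⟩ := hE S ubar hS hT φ hφ hφc
  obtain ⟨R, hR⟩ := exists_eq_zero_of_norm_gt hφc
  obtain ⟨c₁, -, hF₁⟩ := hF S ubar hS
  obtain ⟨c₂, -, hF₂⟩ := hF (S.linearization ubar) 0 hS.linearization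
  have hTmem : T ∈ Icc 0 T := ⟨hT.le, le_rfl⟩
  -- `v(T) = 0` outside the ball of radius `R + c₂ T`
  have hvT : ∀ x : Space d, R + c₂ * T < ‖x‖ → v T x = 0 :=
    hF₂ T R v hv (fun x hx => by rw [hv0 x, hR x hx]) T hTmem
  have hvTc : HasCompactSupport (v T) := by
    simpa using hasCompactSupport_sub_const_of_norm_gt hvT
  -- the fixed radius outside which all the remainder gradients vanish
  set ρ : ℝ := R + max c₁ c₂ * T with hρ
  have hρ₁ : R + c₁ * T ≤ ρ := by
    have := mul_le_mul_of_nonneg_right (le_max_left c₁ c₂) hT.le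
    simpa [hρ] using this
  have hρ₂ : R + c₂ * T ≤ ρ := by
    have := mul_le_mul_of_nonneg_right (le_max_right c₁ c₂) hT.le
    simpa [hρ] using this
  refine ⟨v, hv, hv0, hvTc, u, C / 2 + (volume.real (closedBall (0 : Space d) ρ)) / 2, ?_⟩
  have hpos : ∀ᶠ ε in 𝓝[>] (0 : ℝ), 0 < ε := eventually_mem_nhdsWithin
  filter_upwards [hev, hpos] with ε ⟨hsol, hdata, hint, hrem⟩ hε
  -- `u_ε(T) = ū` outside the ball of radius `R + c₁ T`
  have huT : ∀ x : Space d, R + c₁ * T < ‖x‖ → u ε T x = ubar :=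
    hF₁ T R (u ε) hsol (fun x hx => by rw [hdata x, hR x hx, smul_zero, add_zero]) T hTmem
  refine ⟨hsol, hdata, hasCompactSupport_sub_const_of_norm_gt huT, ?_⟩
  -- the remainder gradient vanishes outside the ball of radius `ρ` ...
  have hsupp : ∀ x : Space d, ρ < ‖x‖ → fderiv ℝ (u ε T) x - ε • fderiv ℝ (v T) x = 0 := by
    intro x hx
    rw [fderiv_eq_zero_of_eq_const_of_norm_gt huT (hρ₁.trans_lt hx),
      fderiv_eq_zero_of_eq_const_of_norm_gt hvT (hρ₂.trans_lt hx), smul_zero, sub_zero]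
  -- ... and is continuous, hence integrable
  have hcont : Continuous fun x => fderiv ℝ (u ε T) x - ε • fderiv ℝ (v T) x :=
    ((hsol.contDiff_slice hTmem).continuous_fderiv one_ne_zero).sub
      (((hv.contDiff_slice hTmem).continuous_fderiv one_ne_zero).const_smul ε)
  have hgi : Integrable fun x => fderiv ℝ (u ε T) x - ε • fderiv ℝ (v T) x := by
    refine hcont.integrable_of_hasCompactSupport ?_
    refine HasCompactSupport.intro (isCompact_closedBall (0 : Space d) ρ) fun x hx => ?_
    rw [mem_closedBall_zero_iff, not_le] at hx
    exact hsupp x hx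
  exact integral_norm_le_of_sq_le hε hgi hint hrem hsupp

end Literature.Barriers.AtomisticToContinuum

end
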